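import Summits.BirchSwinnertonDyer.Rank1Residual.X12.O11.RamifiedStrictDescent
import Summits.BirchSwinnertonDyer.Rank1Residual.X12.CMIsogenyInvariance
import Summits.BirchSwinnertonDyer.Rank1Residual.X12.CMInertTrace
import Summits.BirchSwinnertonDyer.BirchSwinnertonDyer.Theses.RamifiedSevenEllipticUnits
import Literature.NumberTheory.EllipticCurves.ComplexMultiplicationTwistIsogenyCertProofs
import Literature.NumberTheory.EllipticCurves.ComplexMultiplicationMaximalOrderLeavesProofs
import Literature.NumberTheory.EllipticCurves.IsogenyQuadraticTwistProofs
import Literature.NumberTheory.EllipticCurves.IsogenyDualProofs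
import Literature.NumberTheory.EllipticCurves.IsogenyIdProofs
import HarnessLib

set_option linter.dupNamespace false
set_option autoImplicit false

/-!
# Route `RamifiedSevenEllipticUnits` (rung K7r): the cruxes (R-EU) and (R-ctrl) are EQUIVALENT
# modulo `BSD(·, p)` on the isogeny class — support lemmas for items
# `EllipticUnitIndexSeven` (stmt-BirchSwinnertonDyer-19143) and `StrictControlSeven` (stmt-…-19145)

Cell `bsd-cm`, seat `bsd-cm-ram` (g5). HONEST FRAMING: nothing here closes a crux. What is proved is
the exact logical relation between two of the three O11 cruxes as TYPED in
`Rank1Residual/X12/O11/RamifiedStrictDescent.lean`, using only the tree's DISCHARGED index theorem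
`Additive.StrictSha.strictSelmerIndexAt_holds` (`log_p #Sel_str(E/ℚ)[p^∞] = n + log_p #Ш(E/ℚ)[p^∞]`)
and Miller's `BSDp` (`ord_p #Ш_an = ord_p #Ш[p^∞]`):

* `ellipticUnitIndexAt_of_strictControlAt_of_bsdp`: (R-ctrl) at `(W, p)` together with `BSD(W, p)`
  and `BSD(W', p)` for every frame twin `W'` (a globally minimal model of `W^{(d_K)}`) IMPLIES (R-EU)
  at `(W, p)`. Arithmetic: (R-ctrl) says `n₀ + log_p #X[T] = log_p #Sel_str(W) + log_p #Sel_str(W')`;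
  the index theorem rewrites the right side as `n + n' + ord_p #Ш(W)[p^∞] + ord_p #Ш(W')[p^∞]`, and
  `BSDp` replaces the two `Ш`-orders by `ord_p q`, `ord_p q'` (`#Ш_an(W) = q`, `#Ш_an(W') = q'`; the
  witness `q` of `BSDp` is unique since `ℚ → ℂ` is injective).
* `strictControlAt_of_ellipticUnitIndexAt_of_bsdp`: the converse, by the same arithmetic.
* `isIsogenous_of_isFrame`: a frame twin IS `ℚ`-isogenous to `W` (for ANY CM curve: `W ∼ W₀` with
  `j(W₀)` maximal (`exists_isIsogenous_j_mem_maximalCMJInvariants_of_hasCM_holds`), same CM field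
  (`X12.cmFieldDiscrOfJ_eq_of_isIsogenous`), `W₀ ∼ W₀^{(d_K)}` (`isIsogenous_quadraticTwist_cmFieldDiscr_holds`),
  twisting isogenies (`IsIsogenous.quadraticTwist`) and symmetry in characteristic `0`). Hence the
  `BSD(W', p)` hypothesis is implied by "`BSD(V, p)` for every `V` isogenous to `W`" — the shape in
  which Route U delivers `BSD(·, 7)` on the isogeny classes of its members
  (`X12/O11/RouteUIsogenous.lean`, `RouteU.forall_bsdp_of_isIsogenous_twist_cm7_prime`).
* Class level (`p = 7`, 𝒞₇): `ellipticUnitIndexSeven_iff_strictControlSeven_of_bsdp`: granted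
  `BSD(V, 7)` for every globally minimal `V` isogenous to a member of 𝒞₇, the route items
  `EllipticUnitIndexSeven` and `StrictControlSeven` are EQUIVALENT.

CONSEQUENCE FOR THE ROUTE (a remark, not a closing): on the members of 𝒞₇ where `BSD(E, 7)` is known
independently (Route U: the five prime unit-case members `49a1^{(−q)}`, `q ∈ {11, 23, 43, 67, 71}`,
and every further member certified by its Bernoulli criterion) crux #2 `(R-EU)` carries no content
beyond crux #4 `(R-ctrl)`; on the remaining members (generator `7`-divisible in `E(ℚ_7)` or
`7 ∣ #Ш_an`) the two cruxes differ exactly by `BSD(E,7) ∧ BSD(E^{(−7)},7)`, which is the open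
ramified-prime value formula (★_an) of the O11 memo. Nothing is asserted; no named fact is minted.

References: [Miller2011LMS] Def. 1.1; [GreenbergLNM1716] §2 (the index of the generator);
[BurungaleKobayashiNakamuraOta2026] Thm. 3.14 (3), §1.4 (shape only); [Cassels1965ArithmeticVIII].
-/

noncomputable section

open scoped Classical

open WeierstrassCurve NumberField IsDedekindDomain Field PowerSeries
  Literature.NumberTheory.EllipticCurves
  Literature.NumberTheory.EllipticCurves.Rank1Residual
  Literature.NumberTheory.EllipticCurves.Castella2018
  Literature.NumberTheory.GaloisRepresentations
  Summit.BirchSwinnertonDyer.Rank1Residual.Additive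
  Summit.BirchSwinnertonDyer.Rank1Residual.X12.O11

namespace Summit.BirchSwinnertonDyer.BirchSwinnertonDyer.Theorems.RamifiedSevenEllipticUnits

variable {W : WeierstrassCurve ℚ} [W.IsElliptic] {p : ℕ} [Fact p.Prime]

/-! ## §1 The two cruxes at a pair `(W, p)`, modulo `BSD(W, p)` and `BSD(W', p)` -/

omit [W.IsElliptic] in
/-- The rational witness of `BSDp` is pinned: if `#Ш_an(W) = q₀` and `#Ш_an(W) = q` in `ℂ` then
`q = q₀`. [cite: Miller2011LMS, Def. 1.1 (arXiv:1010.2431 p. 3)] -/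
theorem ratCast_shaAn_unique {q q₀ : ℚ} (hq : shaAn W = (q : ℂ)) (hq₀ : shaAn W = (q₀ : ℂ)) :
    q = q₀ := by
  have h : ((q : ℚ) : ℂ) = ((q₀ : ℚ) : ℂ) := hq.symm.trans hq₀
  exact_mod_cast h

/-- **(R-ctrl) ∧ BSD(W, p) ∧ BSD(W', p) ⟹ (R-EU)** at a pair `(W, p)`. Given exact control
`n₀ + log_p #X[T] = log_p #Sel_str(W)[p^∞] + log_p #Sel_str(W')[p^∞]` (`RamifiedCMStrictControlAt`),
Miller's `BSD(W, p)` and `BSD(W', p)` for every frame twin `W'` (globally minimal model of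
`W^{(d_K)}`), the elliptic-unit index law `n₀ + log_p #X[T] = n + n' + ord_p #Ш_an(W) + ord_p #Ш_an(W')`
(`RamifiedCMEllipticUnitIndexAt`) follows: the DISCHARGED index theorem
`StrictSha.strictSelmerIndexAt_holds` gives `log_p #Sel_str = n + ord_p #Ш[p^∞]` for `W` and `W'`,
and `BSDp` gives `ord_p #Ш[p^∞] = ord_p #Ш_an`. Pure arithmetic; nothing asserted about the
Iwasawa module. [cite: Miller2011LMS, Def. 1.1 (arXiv:1010.2431 p. 3)]
[cite: GreenbergLNM1716, §2 (pp. 62–63)] -/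
theorem ellipticUnitIndexAt_of_strictControlAt_of_bsdp (h2 : RamifiedCMStrictControlAt W p)
    (hB : BSDp W p)
    (hB' : ∀ (K : Type) [Field K] [NumberField K] (𝔭 : HeightOneSpectrum (𝓞 K))
      (W' : WeierstrassCurve ℚ) [W'.IsElliptic] [W'.IsGloballyMinimal] (C : VariableChange ℚ),
      IsFrame W p K 𝔭 W' C → BSDp W' p) :
    RamifiedCMEllipticUnitIndexAt W p := by
  intro K _ _ 𝔭 W' _ _ C hF hr κ hκ γ _ P n P' n' hP hgen htors hdiv hndiv hP' hgen' htors' hdiv'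
    hndiv' q q' hq hq' n₀ hchar hfinT
  obtain ⟨-, hfin, q₀, hq₀, hv⟩ := hB
  obtain ⟨-, hfin', q₀', hq₀', hv'⟩ := hB' K 𝔭 W' C hF
  haveI := hfin
  haveI := hfin'
  have e : q = q₀ := ratCast_shaAn_unique hq hq₀
  have e' : q' = q₀' := ratCast_shaAn_unique hq' hq₀'
  subst e e'
  have hctrl := h2 K 𝔭 W' C hF hr κ hκ γ P n P' n' hP hgen htors hdiv hndiv hP' hgen' htors' hdiv'
    hndiv' n₀ hchar hfinT
  have hI := (StrictSha.strictSelmerIndexAt_holds W p).padicValNat_card_eq hP hgen htors hdiv hndiv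
  have hI' := (StrictSha.strictSelmerIndexAt_holds W' p).padicValNat_card_eq hP' hgen' htors' hdiv'
    hndiv'
  rw [hI, hI', Nat.cast_add, Nat.cast_add] at hctrl
  rw [hv, hv']
  linarith

/-- **(R-EU) ∧ BSD(W, p) ∧ BSD(W', p) ⟹ (R-ctrl)** at a pair `(W, p)` — the converse of
`ellipticUnitIndexAt_of_strictControlAt_of_bsdp`, by the same arithmetic read backwards (the
rational witnesses `q, q'` required by (R-EU) are supplied by `BSDp`).
[cite: Miller2011LMS, Def. 1.1 (arXiv:1010.2431 p. 3)] [cite: GreenbergLNM1716, §2 (pp. 62–63)] -/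
theorem strictControlAt_of_ellipticUnitIndexAt_of_bsdp (h3 : RamifiedCMEllipticUnitIndexAt W p)
    (hB : BSDp W p)
    (hB' : ∀ (K : Type) [Field K] [NumberField K] (𝔭 : HeightOneSpectrum (𝓞 K))
      (W' : WeierstrassCurve ℚ) [W'.IsElliptic] [W'.IsGloballyMinimal] (C : VariableChange ℚ),
      IsFrame W p K 𝔭 W' C → BSDp W' p) :
    RamifiedCMStrictControlAt W p := by
  intro K _ _ 𝔭 W' _ _ C hF hr κ hκ γ _ P n P' n' hP hgen htors hdiv hndiv hP' hgen' htors' hdiv'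
    hndiv' n₀ hchar hfinT
  obtain ⟨-, hfin, q, hq, hv⟩ := hB
  obtain ⟨-, hfin', q', hq', hv'⟩ := hB' K 𝔭 W' C hF
  haveI := hfin
  haveI := hfin'
  have heu := h3 K 𝔭 W' C hF hr κ hκ γ P n P' n' hP hgen htors hdiv hndiv hP' hgen' htors' hdiv'
    hndiv' q q' hq hq' n₀ hchar hfinT
  have hI := (StrictSha.strictSelmerIndexAt_holds W p).padicValNat_card_eq hP hgen htors hdiv hndiv
  have hI' := (StrictSha.strictSelmerIndexAt_holds W' p).padicValNat_card_eq hP' hgen' htors' hdiv'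
    hndiv'
  rw [hI, hI', Nat.cast_add, Nat.cast_add]
  rw [hv, hv'] at heu
  linarith

/-! ## §2 A frame twin is `ℚ`-isogenous to `W` -/

omit [Fact p.Prime] in
/-- **A frame twin is isogenous to the curve.** If `IsFrame W p K 𝔭 W' C` (so `W` has CM with CM
field of discriminant `d = cmFieldDiscrOfJ W.j` and `W' = C • W^{(d)}`), then `W ∼ W'` over `ℚ`.
Proof: `W ∼ W₀` with `j(W₀) ∈ maximalCMJInvariants` (Silverman AT Ex. 2.12(b), discharged in the
tree), `d_K(W₀) = d_K(W) = d` (isogeny invariance of the CM field), `W₀ ∼ W₀^{(d)}` (Milne 1972 /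
Burungale–Flach, discharged), `W^{(d)} ∼ W₀^{(d)}` (twisting an isogeny), symmetry and transitivity,
and `W^{(d)} ∼ C • W^{(d)}`. [cite: SilvermanAdvancedTopics1994, Exercise 2.12(b) and App. A §3]
[cite: BurungaleFlach2024, proof of Cor. 2 (arXiv p. 4)] -/
theorem isIsogenous_of_isFrame {K : Type} [Field K] [NumberField K] {𝔭 : HeightOneSpectrum (𝓞 K)}
    {W' : WeierstrassCurve ℚ} [W'.IsElliptic] [W'.IsGloballyMinimal] {C : VariableChange ℚ}
    (hF : IsFrame W p K 𝔭 W' C) : IsIsogenous W W' := by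
  obtain ⟨hCM, -, -, -, -, -, hW'⟩ := hF
  set d : ℤ := cmFieldDiscrOfJ W.j with hd
  have hd0 : (d : ℚ) ≠ 0 := by
    exact_mod_cast Summit.BirchSwinnertonDyer.Rank1Residual.X12.cmFieldDiscrOfJ_ne_zero_of_hasCM W hCM
  haveI := W.isElliptic_quadraticTwist hd0
  -- `W ∼ W₀`, `j(W₀)` maximal, same CM field
  obtain ⟨W₀, _, hiso₀, hj₀⟩ := exists_isIsogenous_j_mem_maximalCMJInvariants_of_hasCM_holds W hCM
  have hdisc : cmFieldDiscr W₀.j = d := by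
    rw [Summit.BirchSwinnertonDyer.Rank1Residual.X12.cmFieldDiscr_eq_cmFieldDiscrOfJ hj₀, hd,
      Summit.BirchSwinnertonDyer.Rank1Residual.X12.cmFieldDiscrOfJ_eq_of_isIsogenous hiso₀ hCM]
  haveI := W₀.isElliptic_quadraticTwist hd0
  -- `W₀ ∼ W₀^{(d)}`
  have h1 : IsIsogenous W₀ (W₀.quadraticTwist (d : ℚ)) := by
    have := isIsogenous_quadraticTwist_cmFieldDiscr_holds W₀ hj₀
    rwa [hdisc] at this
  -- `W^{(d)} ∼ W₀^{(d)}`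
  have h2 : IsIsogenous (W.quadraticTwist (d : ℚ)) (W₀.quadraticTwist (d : ℚ)) :=
    hiso₀.quadraticTwist hd0
  have h3 : IsIsogenous W (W.quadraticTwist (d : ℚ)) :=
    (hiso₀.trans' h1).trans' h2.symm_of_charZero
  have h4 : IsIsogenous W (C • W.quadraticTwist (d : ℚ)) := h3.smul_right C
  rw [hd] at h4
  rwa [hW'] at h4

variable [W.IsGloballyMinimal]

/-- **(R-ctrl) ⟹ (R-EU) at `(W, p)`, granted `BSD(V, p)` on the `ℚ`-isogeny class of `W`** (the
shape in which Route U delivers `BSD(·, 7)`): the frame-twin hypothesis of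
`ellipticUnitIndexAt_of_strictControlAt_of_bsdp` is discharged by `isIsogenous_of_isFrame`.
[cite: Miller2011LMS, Def. 1.1 (arXiv:1010.2431 p. 3)] -/
theorem ellipticUnitIndexAt_of_strictControlAt_of_bsdp_isogenyClass
    (h2 : RamifiedCMStrictControlAt W p)
    (hB : ∀ (V : WeierstrassCurve ℚ) [V.IsElliptic] [V.IsGloballyMinimal],
      IsIsogenous W V → BSDp V p) :
    RamifiedCMEllipticUnitIndexAt W p :=
  ellipticUnitIndexAt_of_strictControlAt_of_bsdp h2 (hB W (IsIsogenous.refl_holds W))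
    fun _ _ _ _ W' _ _ _ hF => hB W' (isIsogenous_of_isFrame hF)

/-- **(R-EU) ⟹ (R-ctrl) at `(W, p)`, granted `BSD(V, p)` on the `ℚ`-isogeny class of `W`.**
[cite: Miller2011LMS, Def. 1.1 (arXiv:1010.2431 p. 3)] -/
theorem strictControlAt_of_ellipticUnitIndexAt_of_bsdp_isogenyClass
    (h3 : RamifiedCMEllipticUnitIndexAt W p)
    (hB : ∀ (V : WeierstrassCurve ℚ) [V.IsElliptic] [V.IsGloballyMinimal],
      IsIsogenous W V → BSDp V p) :
    RamifiedCMStrictControlAt W p :=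
  strictControlAt_of_ellipticUnitIndexAt_of_bsdp h3 (hB W (IsIsogenous.refl_holds W))
    fun _ _ _ _ W' _ _ _ hF => hB W' (isIsogenous_of_isFrame hF)

/-! ## §3 Class level: on 𝒞₇ the route items `EllipticUnitIndexSeven` and `StrictControlSeven`
## are equivalent modulo `BSD(·, 7)` on the isogeny classes of the members -/

/-- **`EllipticUnitIndexSeven ↔ StrictControlSeven` modulo `BSD(·, 7)` on the isogeny classes of
𝒞₇.** Granted Miller's `BSD(V, 7)` for every globally minimal `V` that is `ℚ`-isogenous to a member
of 𝒞₇ (for the Route-U members this is `RouteU.forall_bsdp_of_isIsogenous_twist_cm7_prime` modulo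
its displayed binders; in general it is the K7r leaf itself at `p = 7`), the two crux items of
route `RamifiedSevenEllipticUnits` coincide. So the INDEPENDENT content of the pair
{(R-EU)@7, (R-ctrl)@7} beyond `BSD(E, 7)` is one statement, not two; and on Route-U-certified
members (R-EU)@7 is exactly as hard as (R-ctrl)@7. A remark on the route's structure; closes
nothing. [cite: Miller2011LMS, Def. 1.1 (arXiv:1010.2431 p. 3)]
[cite: BurungaleKobayashiNakamuraOta2026, Thm. 3.14 (3) and §1.4 (arXiv:2608.06879 pp. 24, 8) (shape only)] -/
theorem ellipticUnitIndexSeven_iff_strictControlSeven_of_bsdp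
    (hB : ∀ (W : WeierstrassCurve ℚ) [W.IsElliptic] [W.IsGloballyMinimal],
      Summit.BirchSwinnertonDyer.Rank1Residual.X12.ClassCSeven W →
      ∀ (V : WeierstrassCurve ℚ) [V.IsElliptic] [V.IsGloballyMinimal], IsIsogenous W V → BSDp V 7) :
    Summit.BirchSwinnertonDyer.BirchSwinnertonDyer.Theses.RamifiedSevenEllipticUnits.EllipticUnitIndexSeven ↔
      Summit.BirchSwinnertonDyer.BirchSwinnertonDyer.Theses.RamifiedSevenEllipticUnits.StrictControlSeven := by
  constructor
  · intro h W _ _ _ hW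
    exact strictControlAt_of_ellipticUnitIndexAt_of_bsdp_isogenyClass (h W hW) (hB W hW)
  · intro h W _ _ _ hW
    exact ellipticUnitIndexAt_of_strictControlAt_of_bsdp_isogenyClass (h W hW) (hB W hW)

end Summit.BirchSwinnertonDyer.BirchSwinnertonDyer.Theorems.RamifiedSevenEllipticUnits

end
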